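/-
Copyright (c) 2026. All rights reserved.
Released under Apache 2.0 license as described in the file LICENSE.
-/
import Literature.Geometry.DiscreteGeometry.KissingPatterns
import Summits.AtomisticToContinuum.Crystallization.Theorems.ChargedEnergyGap.Negative.BlocksLocal
import Summits.AtomisticToContinuum.Crystallization.Theorems.ChargedEnergyGap.Negative.PeriodicForm
import Summits.AtomisticToContinuum.Crystallization.Theorems.ChargedEnergyGap.Negative.PeriodicFormConverse

/-!
LANDING NOTE (decomp-a2c hand-1 g18, mechanical): part A of a two-file split of the lens-3 g36 node file (sha256 25b651b9ac39d88e…, 600 l) at the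
§3/§4 boundary (gate 400-line rule); §0 (the port of negative side VII) is DROPPED in favour of the import
`…ChargedEnergyGap.Negative.PeriodicFormConverse` (gate dedup: `Blocks.isChargeFree_toP_iff_motif`, `card_charged_block_ge`, `charged_blockConfig_eq`,
`card_deep_ge`, `periodicPricing_of_noBoundary`, `chargedEnergyGap_iff_periodicPricing` are the tree originals); part B
(`…Theorems.ChargedEnergyGapChartDialB`) carries §4 exact split, §5 dial, §P pins.  Bodies otherwise byte-identical; lint docstrings added.

# `ChargedEnergyGap` — the CHART DIAL: an exact split of the shared crux (slot 2 of every
`RobustDefectLimitWindows` cone) into a GROSS piece and a CHARTED piece, both proved WEAKER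

Decomposition node (cell `decomp-a2c`, lens 3 «one certified translation + split beneath»,
generation 36) on the route item
`Summit.AtomisticToContinuum.Crystallization.Theses.PricedLinkCensus.ChargedEnergyGap`
(`stmt-AtomisticToContinuum-14231`; rank-3 crux of `PricedLinkCensus` AND hypothesis `hCEG` of every
cone of record of `OverbindingBudget.RobustDefectLimitWindows` (`stmt-…-31280`) since generation 26,
e.g. `OverbindingBudgetAffineNearCluster.rdef_of_ceg_shape_nearOrders`; census tag «shared crux ·
OPEN-PROBLEM class»; consumed BY NAME by every other lens, decomposed by none).

## TRANSLATION (the one allowed EQUIV — CITED, tree)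

`ChargedEnergyGapNegative.chargedEnergyGap_iff_periodicPricing :
  ChargedEnergyGap ↔ ∃ κ > 0, PeriodicPricing (1/100) κ` (tree, negative side VII; re-derived here
as `chargedEnergyGap_iff_periodicPricing'` from a verbatim PORT of that file, §0, because its
`.olean` is absent from the farm snapshot at writing),
`PeriodicPricing η κ := ∀ Q periodic, κ · #{charged motif sites} ≤ #motif · (e(Q) − e*)`
(`e* = ⨅_Q e(Q)`; charge = `¬ IsChargeFree (1/100)` read in the infinite point set `Q.points`).
Tag: COSTUME(cite) on its own — it is the typed dictionary finite-`N` / boundary term `C·N^{2/3}`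
↦ periodic / no boundary, and carries no reduction.  The content of the node is the split beneath.

## SPLIT BENEATH (new; every implication below is PROVED in this file, 0 sorry)

Sort the charged motif sites of `Q` by ONE geometric predicate, the **first-shell chart at the
site's own scale** (`ChartedAt θ Q p`): the metric shell
`{q ∈ Q.points | q ≠ p, dist p q ≤ (6/5)·nn(p)}`, recentred at `p` and rescaled by `nn(p)⁻¹`, is a
finite set `θ`-close (`Literature…ShellCloseTo θ`: a bijection onto a rotated copy of the pattern
moving each point by `≤ θ`) to the FCC or to the HCP kissing pattern.  Then for EVERY `θ : ℝ`

* `GrossChargeGap θ`       — `∃ κ > 0, ∀ Q, κ · #{charged ∧ ¬charted_θ} ≤ #motif · (e(Q) − e*)`;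
* `ChartedChargePricing θ` — `∃ κ > 0, ∃ C ≥ 0, ∀ Q,
                               κ · #{charged ∧ charted_θ} ≤ #motif · (e(Q) − e*) + C · #{charged ∧ ¬charted_θ}`;

and (theorems `chargedEnergyGap_iff_pieces`, `chargedEnergyGap_of_pieces`,
`grossChargeGap_of_chargedEnergyGap`, `chartedChargePricing_of_chargedEnergyGap`)

  `ChargedEnergyGap ↔ GrossChargeGap θ ∧ ChartedChargePricing θ`      (exact, for every `θ`).

The glue is the weighted sum `κ₁κ₂/(κ₁+κ₂+C)`; each piece alone is implied by the crux
(drop the other class; debit `C := 0`).  DIAL: `GrossChargeGap` is MONOTONE and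
`ChartedChargePricing` ANTITONE in `θ` (`grossChargeGap_mono`, `chartedChargePricing_anti`): turning
`θ` up moves species from the gross piece into the charted piece; at `θ < 0` nothing is charted,
`ChartedChargePricing θ` is a theorem and `GrossChargeGap θ ↔ ChargedEnergyGap`
(`grossChargeGap_iff_chargedEnergyGap_of_neg`) — the dial interpolates from the crux itself to the
pair (gross core, charted pricing).  Recommended setting `θ⋆ = 3/20` (below).

## TAGS (NODE OUTPUT CONTRACT)

* `GrossChargeGap θ⋆` — piece · WEAKER(proved: `grossChargeGap_of_chargedEnergyGap`; separating
  species: the crux's BINDING species, the symmetric `0.8 %` bond pinch in fcc — `20` charged sites,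
  excess `7.69·10⁻⁴`, price `3.85·10⁻⁵` per charged site, relaxed `≈ 3.4·10⁻⁵` (crux dossier
  `Cruxes/ChargedEnergyGap/Disproof.lean` §7) — has every site displaced by `0.4 %·nn`, hence
  `θ⋆`-charted: it is INVISIBLE to this piece, which therefore cannot be known to imply the crux)
  · IDEA-NEEDED · BARRIER-ringed (`Literature.Barriers.AtomisticToContinuum.TetrahedralFrustration`,
  `…IcosahedralClusters`, `…SutoDegenerateGroundStates`, `…KissingTwelveDegeneracy`: it is the
  quantitative form of «no `θ⋆`-gross local order in periodic matter at energy `e*`», i.e. it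
  contains the value/structure-crystallization core; no technique in print prices non-close-packed
  bulk matter against `e*` for Lennard-Jones in `d = 3`)
  · UNDECIDED(stated test I-CHART(b): the RELATIVE zoo table — excess per site above `e(hcp)` of
  the periodic gross species divided by their `θ⋆`-gross charged fraction; of record (Disproof §7):
  bcc `3.1·10⁻²`, A15/C15 `≥ 2.2·10⁻²`, sc `0.24`, vacancy shell `0.12`, surface `0.17` per site —
  a floor THREE orders above the crux's `κ_max(1/100) ≲ 3.4·10⁻⁵`; kill sign: a `θ⋆`-gross
  periodic species within `10⁻³`/gross site of `e(hcp)` (Frank–Kasper / tcp approximants are the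
  candidates to census)) · INSTRUMENTABLE (relative only: `e*` is not known from below).
* `ChartedChargePricing θ⋆` — piece · WEAKER(proved: `chartedChargePricing_of_chargedEnergyGap`;
  separating species: fully gross periodic matter (every charged site uncharted) makes its
  inequality VACUOUS for `C ≥ e* + 1/24·…` — it says nothing about icosahedral / Frank–Kasper /
  amorphous order, so it cannot be known to imply the crux)
  · ATTACKABLE-L («of a known kind»: discrete nonlinear elasticity of first-shell-charted
  close-packed matter RELATIVE TO `e*` — easier than relative to `e(Barlow)`, the slack
  `e(Barlow) − e* ≥ 0` is free — with a per-site DEBIT at every gross charged site absorbing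
  interfaces; named inputs: the harmonic core `OverbindingBudgetMarginStability.HarmonicPolytypeStability`
  (slot K of the same cone, TRUE-in-evidence, census TAG 193 `λ* = 4.52`), chart straightening
  (slot R `AffineChartStraightening` / `FineChartStraightening`), the bond Taylor ledger
  `OverbindingBudgetLocalBootstrap.bondTaylorExpansion_holds`, finite-strain certificates of the
  census class I-ELAS; first rung = the pinch law `ΔE ≳ 0.4·η²·#pinched bonds` of Disproof §7)
  · INSTRUMENTABLE(stated test I-CHART(c): `κ_P(θ⋆)` := min over the charted charge species of
  excess/#charged — pinch `3.85·10⁻⁵`, homogeneous threshold strains `≥ 1.5·10⁻⁴`, charted planar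
  species to be added; kill sign: a charted charge species riding a zero mode, excluded in
  evidence by `λ* = 4.52 > 0`).
* `ChargeFreeCharted θ` (the DICTIONARY remark, rigidity direction «charge-free ⟹ charted») —
  ASIDE, NOT load-bearing (no theorem of the split uses it): REFUTED for `θ < 1/20` by the twisted
  dozen (`Literature.Barriers.AtomisticToContinuum.FlexibleKissingArrangementsTwist`: `24`
  near-contacts at `0.82 %`, not `1/20`-close; cell negatives `not_krShape12` / `not_kr` of the
  `AperiodicFrustratedLawGap` lineage), UNDECIDED(stated test I-CHART(a): certified maximum of the
  pattern distance over `(1/100)`-charge-free shells; the Kusner–Kusner–Lagarias–Shlosman `√ε` law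
  puts it at `≈ 0.10·nn` at `ε = 1 %`, arXiv:1611.10297 §5) and plausible for `θ ≥ 3/20`; under it
  `GrossChargeGap θ ↔ GrossGap θ` (ALL uncharted sites priced: `grossGap_iff_grossChargeGap_of_dict`).
  This is why `θ⋆ = 3/20`: above the jitterbug reach `≈ 0.10` of charge-free shells, below the
  icosahedral shell's pattern distance `≈ 0.23`.

## Why this node is NOVEL (one sentence)

It is the first decomposition of `ChargedEnergyGap` into pieces each IMPLIED BY the crux — the
three registered crux lines (`Cruxes/ChargedEnergyGap/Lines/{barlow_relative_pricing,
defect_zoom_compactness, two_tolerance_sandwich}`) all TRANSFER it to STRONGER statements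
(Barlow-relative pricing `∋ e(Barlow) = e*`, the `3 %` coarse twin, the GSC Liouville root) — and
the first use of the kissing-pattern chart on this crux that survives
`FlexibleKissingArrangementsTwist` BY CONSTRUCTION: the chart is a SORTING predicate on charged
sites, never a conclusion drawn from charge-freeness, so the exact split holds at every tolerance.

## Why each piece is STRICTLY WEAKER (summary)

crux ⟹ piece: proved (both).  piece ⟹ crux: not known, with a named separating species each way
(pinch for the gross piece, gross bulk order for the charted piece) whose prices differ by three
orders of magnitude in the census of record — the seam sits on a real scale separation, not on a
door predicate.

## Rung currency

Rung 0 → rung 0 (no hypothesis of `AtomisticToContinuum` is discharged).  What moves: slot 2 of the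
cone of record acquires a typed seam `hCEG ⟸ GrossChargeGap θ⋆ ∧ ChartedChargePricing θ⋆`
(compose `chargedEnergyGap_of_pieces` with `rdef_of_ceg_shape_nearOrders` by name), whose charted
half is staffable today and whose gross half is the summit's frustration core, now isolated inside
slot 2 as one inequality over `Mathlib + Literature + e*` (pins §P).

The statements are new combinations of standard notions (periodic configurations, energy per
particle, the scale-free bond graph and its charge, `ShellCloseTo`); no external source is cited for
them.
-/

noncomputable section

open Literature.MathematicalPhysics.StatisticalMechanics
open Literature.Geometry.DiscreteGeometry
open Summit.AtomisticToContinuum.Crystallization.Theses.PricedLinkCensus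
open Summit.AtomisticToContinuum.Crystallization.Theorems.ChargedEnergyGapNegative

namespace Summit.AtomisticToContinuum.Crystallization.Theorems.ChargedEnergyGapChartDial

/-! ## §1 The chart predicate and the two counts -/

/-- The point of `Q.points` under a motif site. -/
abbrev pt (Q : PeriodicConfiguration 3) (x : Q.motif) : Q.points :=
  ⟨x.1, Q.mem_points_of_mem_motif x.2⟩

/-- The own scale of a point `p` of `Q`: its nearest-neighbour distance in `Q.points`. -/
abbrev nn (Q : PeriodicConfiguration 3) (p : Q.points) : ℝ :=
  nearestDist (Subtype.val : Q.points → E3) p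

/-- The first metric shell of `p` at its own scale (radius `(6/5)·nn(p)`), recentred at `p` and
rescaled by `nn(p)⁻¹`. -/
def shellSet (Q : PeriodicConfiguration 3) (p : Q.points) : Set E3 :=
  (fun q : E3 => (nn Q p)⁻¹ • (q - (p : E3))) ''
    {q : E3 | q ∈ Q.points ∧ q ≠ (p : E3) ∧ dist (p : E3) q ≤ 6 / 5 * nn Q p}

/-- **`ChartedAt θ Q p`** — the first shell of `p` at its own scale is a finite set `θ`-close
(`ShellCloseTo`) to the FCC or to the HCP kissing pattern.  A SORTING predicate (never inferred
from charge-freeness in this file). -/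
def ChartedAt (θ : ℝ) (Q : PeriodicConfiguration 3) (p : Q.points) : Prop :=
  ∃ T : Finset E3, (↑T : Set E3) = shellSet Q p ∧
    (ShellCloseTo θ T fccKissingPattern ∨ ShellCloseTo θ T hcpKissingPattern)

/-- A motif site is charged (tolerance `1/100`, charge read in `Q.points`). -/
def Charged (Q : PeriodicConfiguration 3) (x : Q.motif) : Prop :=
  ¬ IsChargeFree (1 / 100) (Subtype.val : Q.points → E3) (pt Q x)

/-- Number of GROSS charged motif sites: charged and not `θ`-charted. -/
def motifChargedGross (θ : ℝ) (Q : PeriodicConfiguration 3) : ℕ :=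
  Nat.card {x : Q.motif // Charged Q x ∧ ¬ ChartedAt θ Q (pt Q x)}

/-- Number of CHARTED charged motif sites: charged and `θ`-charted. -/
def motifChargedCharted (θ : ℝ) (Q : PeriodicConfiguration 3) : ℕ :=
  Nat.card {x : Q.motif // Charged Q x ∧ ChartedAt θ Q (pt Q x)}

/-- Number of uncharted motif sites (charged or not) — for the dictionary remark §5. -/
def motifGross (θ : ℝ) (Q : PeriodicConfiguration 3) : ℕ :=
  Nat.card {x : Q.motif // ¬ ChartedAt θ Q (pt Q x)}

/-- The excess of `Q` above `e*`, times the motif size: the right-hand side of every pricing. -/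
abbrev excess (Q : PeriodicConfiguration 3) : ℝ :=
  (Q.motif.card : ℝ) * (Q.energyPerParticle lennardJones - eStar)

/-! ## §2 The pieces -/

/-- piece · WEAKER(proved `grossChargeGap_of_chargedEnergyGap`) · IDEA-NEEDED · BARRIER-ringed
(TetrahedralFrustration, IcosahedralClusters, SutoDegenerateGroundStates, KissingTwelveDegeneracy) ·
UNDECIDED(test I-CHART(b), relative zoo table; floor of record `≥ 2.2·10⁻²`/site) · INSTRUMENTABLE
(relative).  **Gross charge gap at chart tolerance `θ`**: every periodic configuration pays `κ` per
charged motif site whose own-scale first shell is NOT `θ`-close to a kissing pattern. -/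
def GrossChargeGap (θ : ℝ) : Prop :=
  ∃ κ : ℝ, 0 < κ ∧ ∀ Q : PeriodicConfiguration 3, κ * (motifChargedGross θ Q : ℝ) ≤ excess Q

/-- piece · WEAKER(proved `chartedChargePricing_of_chargedEnergyGap`) · ATTACKABLE-L (discrete
nonlinear elasticity of charted close-packed matter relative to `e*`, gross sites debited; inputs
K `HarmonicPolytypeStability`, R chart straightening, bond Taylor ledger, I-ELAS certificates) ·
INSTRUMENTABLE(test I-CHART(c); binding species the `0.8 %` pinch, `κ_P ≲ 3.85·10⁻⁵`).
**Charted charge pricing at tolerance `θ`**: `κ` per charged `θ`-charted motif site, up to a debit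
`C` per gross charged site. -/
def ChartedChargePricing (θ : ℝ) : Prop :=
  ∃ κ C : ℝ, 0 < κ ∧ 0 ≤ C ∧ ∀ Q : PeriodicConfiguration 3,
    κ * (motifChargedCharted θ Q : ℝ) ≤ excess Q + C * (motifChargedGross θ Q : ℝ)

/-- For the dictionary remark (§5): **gross gap** — ALL uncharted motif sites priced, charged or
not.  Implies `GrossChargeGap θ` outright; equivalent to it under `ChargeFreeCharted θ`. -/
def GrossGap (θ : ℝ) : Prop :=
  ∃ κ : ℝ, 0 < κ ∧ ∀ Q : PeriodicConfiguration 3, κ * (motifGross θ Q : ℝ) ≤ excess Q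

/-- ASIDE · not load-bearing · REFUTED for `θ < 1/20` (`FlexibleKissingArrangementsTwist`) ·
UNDECIDED(test I-CHART(a)) for `θ ≥ 3/20`.  **The dictionary, rigidity direction**: a
`(1/100)`-charge-free point is `θ`-charted. -/
def ChargeFreeCharted (θ : ℝ) : Prop :=
  ∀ (Q : PeriodicConfiguration 3) (p : Q.points),
    IsChargeFree (1 / 100) (Subtype.val : Q.points → E3) p → ChartedAt θ Q p

/-! ## §3 Counting -/

/-- Splitting a finite subtype by a second predicate. -/
theorem natCard_subtype_split {α : Type*} [Finite α] (P R : α → Prop) :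
    Nat.card {a // P a} = Nat.card {a // P a ∧ ¬ R a} + Nat.card {a // P a ∧ R a} := by
  classical
  calc Nat.card {a // P a}
      = Nat.card ({b : {a // P a} // R b.1} ⊕ {b : {a // P a} // ¬ R b.1}) :=
        Nat.card_congr (Equiv.sumCompl fun b : {a // P a} => R b.1).symm
    _ = Nat.card {b : {a // P a} // R b.1} + Nat.card {b : {a // P a} // ¬ R b.1} :=
        Nat.card_sum
    _ = Nat.card {a // P a ∧ R a} + Nat.card {a // P a ∧ ¬ R a} := by
        rw [Nat.card_congr (Equiv.subtypeSubtypeEquivSubtypeInter P R),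
          Nat.card_congr (Equiv.subtypeSubtypeEquivSubtypeInter P fun a => ¬ R a)]
    _ = _ := add_comm _ _

/-- `#charged = #gross charged + #charted charged`. -/
theorem motifCharged_eq_add (θ : ℝ) (Q : PeriodicConfiguration 3) :
    motifCharged (1 / 100) Q = motifChargedGross θ Q + motifChargedCharted θ Q :=
  natCard_subtype_split (fun x : Q.motif => Charged Q x) (fun x => ChartedAt θ Q (pt Q x))

/-- the gross (uncharted) charged count is at most the charged count. [this file, g36] -/
theorem motifChargedGross_le (θ : ℝ) (Q : PeriodicConfiguration 3) :
    motifChargedGross θ Q ≤ motifCharged (1 / 100) Q := by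
  rw [motifCharged_eq_add θ Q]; exact Nat.le_add_right _ _

/-- the charted charged count is at most the charged count. [this file, g36] -/
theorem motifChargedCharted_le (θ : ℝ) (Q : PeriodicConfiguration 3) :
    motifChargedCharted θ Q ≤ motifCharged (1 / 100) Q := by
  rw [motifCharged_eq_add θ Q]; exact Nat.le_add_left _ _

/-- Gross charged sites are uncharted sites. -/
theorem motifChargedGross_le_motifGross (θ : ℝ) (Q : PeriodicConfiguration 3) :
    motifChargedGross θ Q ≤ motifGross θ Q :=
  Nat.card_le_card_of_injective
    (fun x : {x : Q.motif // Charged Q x ∧ ¬ ChartedAt θ Q (pt Q x)} =>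
      (⟨x.1, x.2.2⟩ : {x : Q.motif // ¬ ChartedAt θ Q (pt Q x)}))
    (fun x y h => Subtype.ext (by have h' := congrArg Subtype.val h; simpa using h'))

/-- `0 ≤ excess Q` (`e* ≤ e(Q)`, tree `eStar_le`). -/
theorem excess_nonneg' (Q : PeriodicConfiguration 3) : 0 ≤ excess Q :=
  mul_nonneg (Nat.cast_nonneg _) (sub_nonneg.2 (eStar_le Q))




end Summit.AtomisticToContinuum.Crystallization.Theorems.ChargedEnergyGapChartDial
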